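import Mathlib
import Summits.NavierStokesRegularity.NavierStokesRegularity.Theorems.EulerZoomLiouvillePowerGaugeEulerLiouvilleDriftClockPerigeeTools
import Summits.NavierStokesRegularity.NavierStokesRegularity.Theorems.EulerZoomLiouvillePowerGaugeEulerLiouvilleNeedleFastTime
import HarnessLib

/-!
# «NO APOGEE, NO HOVERING, NO SPIKE ⇒ CLOCK» (class-free, T-D form): strict perigees at the far circular vortical points + a speed floor on the far inflow side + a sub-window Bernoulli envelope clock every vortical ball
# (crux `EulerZoomLiouville.PowerGaugeEulerLiouville` = stmt-NavierStokesRegularity-19832, THE ONE STATEMENT `stub_selfSimilarC2Needle`; the LEAD's T-D «spikes or hovering» in pointwise form; feeds `HasResidenceClock` alt 6)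

Route `EulerZoomLiouville` (NavierStokesRegularity), crux E; width seat ns-ezl-w1 g6.  Setting of the drift clocks (`…DriftClockScale`): `C²` profile `(V, P′)`
at exponent `γ = 1/(2+ρ)`, `W y = γy + V y`, `ℛ(y) = ⟪y, W y⟫` (radial similarity rate), `a(y) = ‖W y‖² + γℛ(y) + ⟪y, DV(y)(W y)⟫ = −(ℛ∘Y)′` along
backward orbits `Y′ = −W(Y)`, `ℋ = ℋ_{P′}` the Bernoulli function, non-decreasing along backward orbits with `(ℋ∘Y)′ = (1−2γ)‖W(Y)‖²` ((3.31)).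
The band-deficit clocks (alternatives 4/7/9/10) need a FLOOR `a ≥ a(R) > 0` on the inflow band.  Here the floor is replaced by three pointwise conditions at
the far vortical points of ONE Bernoulli super-level set `{ℋ > h}` through ONE vortical point `x₀`:
(P) NO APOGEE — every exactly circular point (`ℛ = 0`) is a strict perigee of its label: `a > 0` there (pointwise, no uniformity);
(F) NO HOVERING ON THE INFLOW SIDE — `‖W‖ ≥ w₀ > 0` wherever `ℛ ≤ 0`;
(E) NO SPIKE — a Bernoulli envelope `ℋ(y) − ℋ(y′) ≤ C r^θ` for far vortical high `y, y′` in `B̄(0, r)`, with `θ < 2+ρ`.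
MECHANISM.  A lingering label (backward orbit in `‖·‖ ≤ 2R` for similarity time `c′R^{2+ρ}`) not confined near the origin exits the sphere `‖·‖ = R_*` at a
time `σ₁ ≤ n₀` with `ℛ ≤ 0`; by (P) the radial rate can never return to positive values (at a first return `ℛ = 0` and `(ℛ∘Y)′ = −a < 0`), so the label
stays far and on the inflow side until the horizon; by (F) its Bernoulli value grows at rate `≥ (1−2γ)w₀²`, by (E) it can grow by at most `C(2R)^θ` inside
the window — impossible for `c′R^{2+ρ} − n₀ > C(2R)^θ/((1−2γ)w₀²)`.  Hence lingering labels are near-confined for time `n₀`, a set of at most half the blob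
(W3b), exactly as in the drift clocks.

* (tools file `…DriftClockPerigeeTools`: `DriftClock.rate_nonpos_of_perigee` — (P) ⇒ «no return».)
* `DriftClock.powerClockAt_of_perigee_fast_envelope` — (P)+(F)+(E) above one level through one vortical `x₀` ⇒ the POWER residence clock AT `x₀` (every `c′ > 0`),
  i.e. the `∃ x₀ r …` hypothesis of `NeedleRace.selfSimilar_ae_eq_zero_of_localPowerClockC2` / `…_past`.

WHAT THIS IS NOT: not NS, not E — a class-free ODE/measure lemma about `C²` profiles (no budgets), `--supports` stmt-19832; the crux is OPEN;
NS regularity is NOT proved. [folklore; cf. ConstantinIgnatovaVicol2026Putative §3.4 (3.19)–(3.22), §3.4.3 (3.29)–(3.31), §3.5]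
-/

noncomputable section

-- flat `Theorems/<Route><Decl>…` files of one crux share the namespace of the crux (tree convention: `Summit.<S>.<S>.…`)
set_option linter.dupNamespace false

open Set Filter Topology Metric MeasureTheory
open scoped RealInnerProductSpace ENNReal

namespace Summit.NavierStokesRegularity.NavierStokesRegularity.Theorems.PowerGaugeEulerLiouville

open Literature.Analysis Literature.Analysis.FluidPDE

namespace DriftClock

open ChannelClock

/-- **«NO APOGEE, NO HOVERING, NO SPIKE ⇒ CLOCK»**: a vortical `x₀`, a level `h < ℋ_{P′}(x₀)`, and beyond some radius, at the vortical points of `{ℋ_{P′} > h}`: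
(P) strict perigees at the circular points (`ℛ = 0 ⇒ a > 0`), (F) a speed floor `‖W‖ ≥ w₀ > 0` on the inflow side `ℛ ≤ 0`, (E) a Bernoulli envelope
`ℋ(y) − ℋ(y′) ≤ C r^θ` (`‖y‖, ‖y′‖ ≤ r`, `θ < 2+ρ`) ⇒ the POWER residence clock AT `x₀` (every `c′ > 0`; the `∃ x₀ r …` hypothesis of
`NeedleRace.selfSimilar_ae_eq_zero_of_localPowerClockC2`). [folklore; cf. ConstantinIgnatovaVicol2026Putative §3.4–§3.5] -/
theorem powerClockAt_of_perigee_fast_envelope {ρ : ℝ} (hρ : 0 < ρ) (hρh : ρ ≤ 1 / 2)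
    {V : EuclideanSpace ℝ (Fin 3) → EuclideanSpace ℝ (Fin 3)} {P' : EuclideanSpace ℝ (Fin 3) → ℝ}
    (hprof : IsSelfSimilarEulerProfile (1 / (2 + ρ)) 0 V P') {x₀ : EuclideanSpace ℝ (Fin 3)} (hx₀ : curl V x₀ ≠ 0) {h : ℝ}
    (hh : h < selfSimilarBernoulli (1 / (2 + ρ)) 0 V P' x₀)
    (hper : ∃ R₀ : ℝ, ∀ y : EuclideanSpace ℝ (Fin 3), R₀ ≤ ‖y‖ → h < selfSimilarBernoulli (1 / (2 + ρ)) 0 V P' y → curl V y ≠ 0 →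
      ⟪y, selfSimilarTransport (1 / (2 + ρ)) 0 V y⟫ = 0 →
      0 < ‖selfSimilarTransport (1 / (2 + ρ)) 0 V y‖ ^ 2 + (1 / (2 + ρ)) * ⟪y, selfSimilarTransport (1 / (2 + ρ)) 0 V y⟫ +
        ⟪y, fderiv ℝ V y (selfSimilarTransport (1 / (2 + ρ)) 0 V y)⟫)
    (hfast : ∃ w₀ : ℝ, 0 < w₀ ∧ ∃ R₀ : ℝ, ∀ y : EuclideanSpace ℝ (Fin 3), R₀ ≤ ‖y‖ →
      h < selfSimilarBernoulli (1 / (2 + ρ)) 0 V P' y → curl V y ≠ 0 → ⟪y, selfSimilarTransport (1 / (2 + ρ)) 0 V y⟫ ≤ 0 →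
      w₀ ≤ ‖selfSimilarTransport (1 / (2 + ρ)) 0 V y‖)
    (henv : ∃ C θ R₀ : ℝ, θ < 2 + ρ ∧ ∀ (r : ℝ) (y y' : EuclideanSpace ℝ (Fin 3)), R₀ ≤ ‖y‖ → ‖y‖ ≤ r → R₀ ≤ ‖y'‖ → ‖y'‖ ≤ r →
      h < selfSimilarBernoulli (1 / (2 + ρ)) 0 V P' y → curl V y ≠ 0 →
      h < selfSimilarBernoulli (1 / (2 + ρ)) 0 V P' y' → curl V y' ≠ 0 →
      selfSimilarBernoulli (1 / (2 + ρ)) 0 V P' y - selfSimilarBernoulli (1 / (2 + ρ)) 0 V P' y' ≤ C * r ^ θ) :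
    ∀ c' : ℝ, 0 < c' → ∃ r : ℝ, 0 < r ∧ ∃ R₀ : ℝ,
      ∀ R : ℝ, R₀ ≤ R → ∀ (V' : EuclideanSpace ℝ (Fin 3) → EuclideanSpace ℝ (Fin 3)) (K Rbig : ℝ), ContDiff ℝ 2 V' →
        (∀ y, ‖fderiv ℝ V' y‖ ≤ K) → 2 * R < Rbig →
        (∀ w ∈ ball (0 : EuclideanSpace ℝ (Fin 3)) Rbig, V' w = V w) →
        (volume (ball x₀ r ∩ {y | ∀ σ ∈ Icc 0 (c' * R ^ (2 + ρ)),
          ‖ODE.evolutionMap (fun _ : ℝ => selfSimilarTransport (1 / (2 + ρ)) 0 V') 0 (-σ) y‖ ≤ 2 * R})).toReal ≤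
          (volume (ball x₀ r)).toReal / 2 := by
  intro c' hc'
  set γ : ℝ := 1 / (2 + ρ) with hγdef
  have h2ρ : (0 : ℝ) < 2 + ρ := by linarith
  have hγ : 0 < γ := one_div_pos.2 h2ρ
  have hγ2 : γ < 1 / 2 := one_div_lt_one_div_of_lt two_pos (by linarith)
  have h12γ : 0 < 1 - 2 * γ := by linarith
  have hU2 : ContDiff ℝ 2 V := hprof.contDiff_velocity
  -- ### the blob: a small ball inside `{ℋ > h} ∩ {curl ≠ 0}` around `x₀`
  have hHc : Continuous (selfSimilarBernoulli γ 0 V P') := hprof.contDiff_selfSimilarBernoulli.continuous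
  have hcurlc : Continuous (curl V) := (differentiable_curl_of_contDiff hU2).continuous
  have hOopen : IsOpen {y : EuclideanSpace ℝ (Fin 3) | h < selfSimilarBernoulli γ 0 V P' y ∧ curl V y ≠ 0} := by
    rw [setOf_and]
    exact (isOpen_lt continuous_const hHc).inter (isOpen_ne_fun hcurlc continuous_const)
  have hx₀O : x₀ ∈ {y : EuclideanSpace ℝ (Fin 3) | h < selfSimilarBernoulli γ 0 V P' y ∧ curl V y ≠ 0} :=
    ⟨hh, hx₀⟩
  obtain ⟨r₀, hr₀, hball₀⟩ := Metric.isOpen_iff.1 hOopen x₀ hx₀O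
  set r : ℝ := min r₀ 1 with hrdef
  have hr : 0 < r := lt_min hr₀ one_pos
  have hr1 : r ≤ 1 := min_le_right _ _
  have hballO : ∀ y ∈ ball x₀ r, h < selfSimilarBernoulli γ 0 V P' y ∧ curl V y ≠ 0 :=
    fun y hy => hball₀ (ball_subset_ball (min_le_left _ _) hy)
  -- ### the far thresholds of (P), (F), (E), and the hitting radius `R_* ≥ 2R₁`
  obtain ⟨Rp, hRp⟩ := hper
  obtain ⟨w₀, hw₀, Rw, hRw⟩ := hfast
  obtain ⟨C, θ, Re, hθ, hRe⟩ := henv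
  set R₁ : ℝ := max (max Rp Rw) (max Re 1) with hR₁def
  have hR₁p : Rp ≤ R₁ := le_trans (le_max_left _ _) (le_max_left _ _)
  have hR₁w : Rw ≤ R₁ := le_trans (le_max_right _ _) (le_max_left _ _)
  have hR₁e : Re ≤ R₁ := le_trans (le_max_left _ _) (le_max_right _ _)
  have hR₁1 : 1 ≤ R₁ := le_trans (le_max_right _ _) (le_max_right _ _)
  have hR₁pos : 0 < R₁ := lt_of_lt_of_le one_pos hR₁1
  set Rs : ℝ := max (2 * R₁) (‖x₀‖ + 2) with hRsdef
  have hRs2R₁ : 2 * R₁ ≤ Rs := le_max_left _ _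
  have hRs1 : 1 ≤ Rs := le_trans (by linarith) hRs2R₁
  have hRspos : 0 < Rs := by linarith
  have hballRs : ∀ y ∈ ball x₀ r, ‖y‖ < Rs - 1 := by
    intro y hy
    have h1 : dist y x₀ < r := mem_ball.1 hy
    have h2 : ‖y‖ ≤ dist y x₀ + ‖x₀‖ := by
      have := dist_triangle y x₀ 0
      rwa [dist_zero_right, dist_zero_right] at this
    linarith [le_max_right (2 * R₁) (‖x₀‖ + 2)]
  -- ### the R-independent cut-off orbit and the near-confinement sets
  obtain ⟨V₀, hV₀, -, -, ⟨K₀, hK₀⟩, hagree₀⟩ := Loc.exists_cutoff_local hU2 (R := Rs + 1) (by linarith)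
  have hV₀1 : ContDiff ℝ 1 V₀ := hV₀.of_le (by norm_num)
  have hW₀eq : ∀ z : EuclideanSpace ℝ (Fin 3), ‖z‖ < Rs + 1 → selfSimilarTransport γ 0 V₀ z = selfSimilarTransport γ 0 V z := by
    intro z hz
    simp only [selfSimilarTransport_apply, hagree₀ z (by rwa [mem_ball, dist_zero_right])]
  set Φ₀ := ODE.evolutionMap (fun _ : ℝ => selfSimilarTransport γ 0 V₀) 0 with hΦ₀
  set Sn : ℕ → Set (EuclideanSpace ℝ (Fin 3)) := fun n =>
    ball x₀ r ∩ {y | ∀ σ ∈ Icc (0 : ℝ) n, ‖Φ₀ (-σ) y‖ ≤ Rs} with hSndef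
  have hSn_meas : ∀ n, MeasurableSet (Sn n) := by
    intro n
    refine measurableSet_ball.inter (IsClosed.measurableSet ?_)
    have : {y : EuclideanSpace ℝ (Fin 3) | ∀ σ ∈ Icc (0 : ℝ) n, ‖Φ₀ (-σ) y‖ ≤ Rs} =
        ⋂ σ ∈ Icc (0 : ℝ) n, {y | ‖Φ₀ (-σ) y‖ ≤ Rs} := by ext y; simp
    rw [this]
    refine isClosed_biInter fun σ _ => ?_
    exact isClosed_le ((C2.Kelvin.contDiff_flow (γ := γ) hV₀ hK₀ (-σ)).continuous.norm) continuous_const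
  have hSn_anti : Antitone Sn := by
    intro m n hmn y hy
    refine ⟨hy.1, fun σ hσ => hy.2 σ ⟨hσ.1, le_trans hσ.2 (by exact_mod_cast hmn)⟩⟩
  -- the intersection is inside the confined vortical set, null by W3b
  have hInter_null : volume (⋂ n, Sn n) = 0 := by
    refine measure_mono_null ?_ (Loc.volume_vortical_confined_eq_zero hprof hγ hγ2 hRspos)
    intro y hy
    rw [mem_iInter] at hy
    have hy0 : y ∈ ball x₀ r := (hy 0).1
    refine ⟨(hballO y hy0).2, fun t => Φ₀ (-t) y, by simp [hΦ₀, ODE.evolutionMap_self], ?_, ?_⟩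
    · intro t ht
      have hconf : ‖Φ₀ (-t) y‖ ≤ Rs := by
        obtain ⟨n, hn⟩ := exists_nat_ge t
        exact (hy n).2 t ⟨ht, hn⟩
      have hd := C2.Kelvin.hasDerivAt_flow_neg (γ := γ) hV₀1 hK₀ y t
      rw [hW₀eq _ (by linarith)] at hd
      exact hd
    · intro t ht
      obtain ⟨n, hn⟩ := exists_nat_ge t
      exact (hy n).2 t ⟨ht, hn⟩
  have htend : Tendsto (volume ∘ Sn) atTop (𝓝 0) := by
    rw [← hInter_null]
    exact tendsto_measure_iInter_atTop (fun n => (hSn_meas n).nullMeasurableSet) hSn_anti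
      ⟨0, (measure_mono inter_subset_left).trans_lt measure_ball_lt_top |>.ne⟩
  -- choose `n₀` with `volume (Sn n₀) ≤ volume (ball x₀ r) / 2`
  have hvpos : 0 < volume (ball x₀ r) := measure_ball_pos volume x₀ hr
  have hvtop : volume (ball x₀ r) < ∞ := measure_ball_lt_top
  have hhalf_pos : (0 : ℝ≥0∞) < volume (ball x₀ r) / 2 := ENNReal.half_pos hvpos.ne'
  obtain ⟨n₀, hn₀⟩ := (htend.eventually (ge_mem_nhds hhalf_pos)).exists
  -- ### the clock radius (atTop eventuality): `n₀ + 1 ≤ c′R^{2+ρ}/2` and the envelope budget `A R^θ ≤ c′R^{2+ρ}/2`, `A = |C| 2^θ / ((1−2γ) w₀²)`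
  set A : ℝ := |C| * (2 : ℝ) ^ θ / ((1 - 2 * γ) * w₀ ^ 2) with hAdef
  have hA0 : 0 ≤ A := by positivity
  have hev : ∀ᶠ R : ℝ in atTop, Rs ≤ R ∧ (n₀ : ℝ) + 1 ≤ c' / 2 * R ^ (2 + ρ) ∧ A * R ^ θ ≤ c' / 2 * R ^ (2 + ρ) := by
    have hlim : Tendsto (fun R : ℝ => c' / 2 * R ^ (2 + ρ)) atTop atTop :=
      (tendsto_rpow_atTop (by linarith)).const_mul_atTop (by positivity)
    have hgen : ∀ᶠ R : ℝ in atTop, A * R ^ θ ≤ c' / 2 * R ^ (2 + ρ) := by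
      have hl : Tendsto (fun R : ℝ => A * R ^ (θ - (2 + ρ))) atTop (𝓝 0) := by
        have h := tendsto_rpow_neg_atTop (show 0 < (2 + ρ) - θ by linarith)
        have h' : Tendsto (fun R : ℝ => A * R ^ (-((2 + ρ) - θ))) atTop (𝓝 (A * 0)) := h.const_mul A
        rw [mul_zero] at h'
        refine h'.congr' (Eventually.of_forall fun R => ?_)
        simp only [neg_sub]
      have hsmall : ∀ᶠ R : ℝ in atTop, A * R ^ (θ - (2 + ρ)) < c' / 2 := (tendsto_order.1 hl).2 _ (by positivity)
      filter_upwards [hsmall, eventually_gt_atTop (0 : ℝ)] with R hR hR0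
      have hsplit : A * R ^ θ = A * R ^ (θ - (2 + ρ)) * R ^ (2 + ρ) := by
        rw [mul_assoc, ← Real.rpow_add hR0]; ring_nf
      rw [hsplit]
      have hRpow : 0 < R ^ (2 + ρ) := Real.rpow_pos_of_pos hR0 _
      exact mul_le_mul_of_nonneg_right hR.le hRpow.le
    filter_upwards [eventually_ge_atTop Rs, hlim.eventually_ge_atTop ((n₀ : ℝ) + 1), hgen] with R hRs h1 h2
    exact ⟨hRs, h1, h2⟩
  obtain ⟨R₀, hR₀⟩ := Filter.eventually_atTop.1 hev
  refine ⟨r, hr, R₀, fun R hR V' K Rbig hV' hK' hRbig hagree' => ?_⟩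
  obtain ⟨hRRs, hcost1, hcost2⟩ := hR₀ R hR
  have hR1 : 1 ≤ R := le_trans hRs1 hRRs
  have hRpos : 0 < R := by linarith
  have hn₀_nonneg : (0 : ℝ) ≤ n₀ := Nat.cast_nonneg n₀
  set TR : ℝ := c' * R ^ (2 + ρ) with hTRdef
  have hTR_ge : (n₀ : ℝ) + 1 + A * R ^ θ ≤ TR := by
    have : TR = c' / 2 * R ^ (2 + ρ) + c' / 2 * R ^ (2 + ρ) := by rw [hTRdef]; ring
    rw [this]; linarith only [hcost1, hcost2]
  -- ### the main inclusion: lingering labels lie in `Sn n₀`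
  have hV'1 : ContDiff ℝ 1 V' := hV'.of_le (by norm_num)
  have hW'eq : ∀ z : EuclideanSpace ℝ (Fin 3), ‖z‖ < Rbig → selfSimilarTransport γ 0 V' z = selfSimilarTransport γ 0 V z := by
    intro z hz
    simp only [selfSimilarTransport_apply, hagree' z (by rwa [mem_ball, dist_zero_right])]
  set Φ' := ODE.evolutionMap (fun _ : ℝ => selfSimilarTransport γ 0 V') 0 with hΦ'
  have hincl : ball x₀ r ∩ {y | ∀ σ ∈ Icc 0 TR, ‖Φ' (-σ) y‖ ≤ 2 * R} ⊆ Sn n₀ := by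
    rintro y ⟨hyB, hling⟩
    refine ⟨hyB, ?_⟩
    rw [mem_setOf_eq]
    by_contra hnot
    push Not at hnot
    obtain ⟨σ₀, hσ₀, hfar₀⟩ := hnot
    -- the two orbits
    set Y : ℝ → EuclideanSpace ℝ (Fin 3) := fun t => Φ' (-t) y with hYdef
    set Y₀ : ℝ → EuclideanSpace ℝ (Fin 3) := fun t => Φ₀ (-t) y with hY₀def
    have hYd : ∀ t, HasDerivAt Y ((-1 : ℝ) • selfSimilarTransport γ 0 V' (Y t)) t :=
      fun t => C2.Kelvin.hasDerivAt_flow_neg (γ := γ) hV'1 hK' y t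
    have hY₀d : ∀ t, HasDerivAt Y₀ ((-1 : ℝ) • selfSimilarTransport γ 0 V₀ (Y₀ t)) t :=
      fun t => C2.Kelvin.hasDerivAt_flow_neg (γ := γ) hV₀1 hK₀ y t
    have hYc : Continuous Y := continuous_iff_continuousAt.2 fun t => (hYd t).continuousAt
    have hY₀c : Continuous Y₀ := continuous_iff_continuousAt.2 fun t => (hY₀d t).continuousAt
    have hY0 : Y 0 = y := by simp [hYdef, hΦ', ODE.evolutionMap_self]
    have hY₀0 : Y₀ 0 = y := by simp [hY₀def, hΦ₀, ODE.evolutionMap_self]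
    -- first hit of the sphere `‖·‖ = Rs` by the cut-off orbit, at a time `σ₁ ∈ (0, σ₀]`
    have hy_lt : ‖Y₀ 0‖ < Rs := by rw [hY₀0]; linarith [hballRs y hyB]
    obtain ⟨σ₁, hσ₁pos, hσ₁le, hhit, hinside⟩ :=
      exists_first_hit (f := fun t => ‖Y₀ t‖) hσ₀.1 (hY₀c.norm.continuousOn) hy_lt hfar₀.le
    have hσ₁n₀ : σ₁ ≤ n₀ := le_trans hσ₁le hσ₀.2
    -- on `[0, σ₁]` the cut-off orbit is a `V'`-orbit; by uniqueness `Y = Y₀` there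
    have hRs_lt_Rbig : Rs + 1 ≤ Rbig := by linarith
    have hY₀V' : ∀ t ∈ Icc 0 σ₁, HasDerivAt Y₀ ((-1 : ℝ) • selfSimilarTransport γ 0 V' (Y₀ t)) t := by
      intro t ht
      have hn : ‖Y₀ t‖ ≤ Rs := hinside t ht
      have hd := hY₀d t
      rw [hW₀eq _ (by linarith), ← hW'eq _ (by linarith)] at hd
      exact hd
    have hL' := C2.Kelvin.lipschitzWith_selfSimilarTransport (γ := γ) hV'1 hK'
    have hLneg : LipschitzWith (Real.toNNReal (|γ| + K)) (fun z => (-1 : ℝ) • selfSimilarTransport γ 0 V' z) :=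
      LipschitzWith.of_dist_le_mul fun a b => by
        rw [neg_one_smul, neg_one_smul, dist_neg_neg]
        exact hL'.dist_le_mul a b
    have hEq : EqOn Y₀ Y (Icc 0 σ₁) :=
      ODE_solution_unique (v := fun _ z => (-1 : ℝ) • selfSimilarTransport γ 0 V' z)
        (fun _ => hLneg)
        (hY₀c.continuousOn) (fun t ht => (hY₀V' t (Ico_subset_Icc_self ht)).hasDerivWithinAt)
        (hYc.continuousOn) (fun t _ => (hYd t).hasDerivWithinAt) (by rw [hY₀0, hY0])
    have hYσ₁ : ‖Y σ₁‖ = Rs := by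
      rw [← hEq (right_mem_Icc.2 hσ₁pos.le)]; exact hhit
    -- on `[0, TR]` the `V'`-orbit stays in `B̄(0,2R) ⊆ ball 0 Rbig`: it is a `V`-arc there
    have hTR0 : 0 ≤ TR := by rw [hTRdef]; exact mul_nonneg hc'.le (Real.rpow_nonneg hRpos.le _)
    have hσ₁TR : σ₁ ≤ TR := by
      have : 0 ≤ A * R ^ θ := mul_nonneg hA0 (Real.rpow_nonneg hRpos.le _)
      linarith only [hTR_ge, this, hσ₁n₀]
    have hYV : ∀ t ∈ Icc 0 TR, HasDerivAt Y (-(selfSimilarTransport γ 0 V (Y t))) t := by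
      intro t ht
      have hn : ‖Y t‖ ≤ 2 * R := hling t ht
      have hd := hYd t
      rw [neg_one_smul, hW'eq _ (by linarith)] at hd
      exact hd
    -- Bernoulli-high and vortical along the whole arc
    have hhighY : ∀ t ∈ Icc 0 TR, h < selfSimilarBernoulli γ 0 V P' (Y t) := by
      intro t ht
      have hmono := bernoulli_le_of_arc hprof hγ2.le ht.1 (fun s hs => hYV s ⟨hs.1, le_trans hs.2 ht.2⟩)
      rw [hY0] at hmono
      exact lt_of_lt_of_le (hballO y hyB).1 hmono
    have hvortY : ∀ t ∈ Icc 0 TR, curl V (Y t) ≠ 0 := by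
      intro t ht
      have h0 : curl V (Y 0) ≠ 0 := by rw [hY0]; exact (hballO y hyB).2
      exact OutflowDive.vorticityTransport ρ hρ hρh V P' hprof t ht.1 Y
        (fun s hs => hYV s ⟨hs.1, le_trans hs.2 ht.2⟩) h0
    -- ### the radial rate at the first hit is `≤ 0`
    have hV1 : ContDiff ℝ 1 V := hU2.of_le (by norm_num)
    have hrate₁ : ⟪Y σ₁, selfSimilarTransport γ 0 V (Y σ₁)⟫ ≤ 0 := by
      by_contra hpos
      push Not at hpos
      -- `N = ‖Y‖²` has derivative `−2ℛ < 0` at `σ₁`, so it was larger just before: contradiction with `‖Y‖ ≤ Rs` on `[0, σ₁]`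
      have hNd : HasDerivAt (fun s => ‖Y s‖ ^ 2) (2 * ⟪Y σ₁, -(selfSimilarTransport γ 0 V (Y σ₁))⟫) σ₁ :=
        (hYV σ₁ ⟨hσ₁pos.le, hσ₁TR⟩).norm_sq
      have hneg : 2 * ⟪Y σ₁, -(selfSimilarTransport γ 0 V (Y σ₁))⟫ < 0 := by
        rw [inner_neg_right]; linarith
      have hev := Literature.NumberTheory.LFunctions.Nicolas.eventually_nhdsLT_lt_of_hasDerivAt_neg hNd hneg
      have hev2 : ∀ᶠ z in 𝓝[<] σ₁, 0 ≤ z := Filter.eventually_of_mem (Ioo_mem_nhdsLT hσ₁pos) fun z hz => hz.1.le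
      obtain ⟨z, ⟨hz, hz0⟩, hzlt⟩ := ((hev.and hev2).and self_mem_nhdsWithin).exists
      have hzle : ‖Y z‖ ≤ Rs := by
        rw [← hEq ⟨hz0, (le_of_lt hzlt)⟩]; exact hinside z ⟨hz0, le_of_lt hzlt⟩
      have h1 : ‖Y z‖ ^ 2 ≤ Rs ^ 2 := pow_le_pow_left₀ (norm_nonneg _) hzle 2
      rw [hYσ₁] at hz
      linarith
    -- ### (P): no return — `ℛ ≤ 0` and `‖Y‖ ≥ R_*` on `[σ₁, TR]`
    have hsub : Icc σ₁ TR ⊆ Icc 0 TR := fun s hs => ⟨le_trans hσ₁pos.le hs.1, hs.2⟩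
    have hR₁Rs : R₁ ≤ Rs := by linarith
    have hYσ₁' : R₁ ≤ ‖Y σ₁‖ := by rw [hYσ₁]; exact hR₁Rs
    have hnoret := rate_nonpos_of_perigee (γ := γ) (P' := P') hV1 (R₁ := R₁) (h := h) (t₀ := σ₁) (t₁ := TR)
      (fun y hy hh hc h0 => hRp y (hR₁p.trans hy) hh hc h0)
      (fun s hs => hYV s (hsub hs)) (fun s hs => hhighY s (hsub hs)) (fun s hs => hvortY s (hsub hs)) hYσ₁' hrate₁
    have hfarY : ∀ s ∈ Icc σ₁ TR, Rs ≤ ‖Y s‖ := fun s hs => by rw [← hYσ₁]; exact (hnoret s hs).2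
    -- ### (F): Bernoulli growth `ℋ(Y TR) − ℋ(Y σ₁) ≥ (1−2γ) w₀² (TR − σ₁)`
    have hYV' : ∀ t ∈ Icc σ₁ TR, HasDerivAt Y ((-1 : ℝ) • selfSimilarTransport γ 0 V (Y t)) t := by
      intro t ht; rw [neg_one_smul]; exact hYV t (hsub ht)
    have hident := NeedleClock.bernoulli_comp_sub_eq_of_Icc hprof (s := (-1 : ℝ)) hσ₁TR hYV'
    have hWc : Continuous (selfSimilarTransport γ 0 V) := by
      have e : selfSimilarTransport γ 0 V = fun y => γ • (y - 0) + V y := rfl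
      rw [e]; exact ((continuous_id.sub continuous_const).const_smul γ).add hU2.continuous
    have hYcI : ContinuousOn Y (Icc σ₁ TR) := hYc.continuousOn
    have hint : IntervalIntegrable (fun t => ‖selfSimilarTransport γ 0 V (Y t)‖ ^ 2) volume σ₁ TR :=
      (((hWc.comp hYc).norm.pow 2).continuousOn).intervalIntegrable
    have hlow : ∀ t ∈ Icc σ₁ TR, w₀ ^ 2 ≤ ‖selfSimilarTransport γ 0 V (Y t)‖ ^ 2 := by
      intro t ht
      have hw := hRw (Y t) (hR₁w.trans (hR₁Rs.trans (hfarY t ht))) (hhighY t (hsub ht)) (hvortY t (hsub ht)) (hnoret t ht).1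
      exact pow_le_pow_left₀ hw₀.le hw 2
    have hintge : w₀ ^ 2 * (TR - σ₁) ≤ ∫ t in σ₁..TR, ‖selfSimilarTransport γ 0 V (Y t)‖ ^ 2 := by
      have h1 : ∫ _ in σ₁..TR, w₀ ^ 2 = (TR - σ₁) * w₀ ^ 2 := by
        rw [intervalIntegral.integral_const, smul_eq_mul]
      have h2 := intervalIntegral.integral_mono_on hσ₁TR intervalIntegrable_const hint hlow
      rw [h1] at h2; linarith only [h2]
    have hgrow : (1 - 2 * γ) * (w₀ ^ 2 * (TR - σ₁)) ≤
        selfSimilarBernoulli γ 0 V P' (Y TR) - selfSimilarBernoulli γ 0 V P' (Y σ₁) := by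
      rw [hident]
      have e : (-1 : ℝ) * (2 * γ - 1) = 1 - 2 * γ := by ring
      rw [e]
      exact mul_le_mul_of_nonneg_left hintge h12γ.le
    -- ### (E): the envelope on the window `‖·‖ ≤ 2R`
    have henvY : selfSimilarBernoulli γ 0 V P' (Y TR) - selfSimilarBernoulli γ 0 V P' (Y σ₁) ≤ C * (2 * R) ^ θ :=
      hRe (2 * R) (Y TR) (Y σ₁) (hR₁e.trans (hR₁Rs.trans (hfarY TR (right_mem_Icc.2 hσ₁TR)))) (hling TR (right_mem_Icc.2 hTR0))
        (hR₁e.trans hYσ₁') (hling σ₁ ⟨hσ₁pos.le, hσ₁TR⟩)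
        (hhighY TR (right_mem_Icc.2 hTR0)) (hvortY TR (right_mem_Icc.2 hTR0))
        (hhighY σ₁ ⟨hσ₁pos.le, hσ₁TR⟩) (hvortY σ₁ ⟨hσ₁pos.le, hσ₁TR⟩)
    -- ### contradiction: `(1−2γ)w₀²(TR − σ₁) ≤ C(2R)^θ ≤ (1−2γ)w₀² · A R^θ`, but `TR − σ₁ ≥ TR − n₀ > A R^θ`
    have hCA : C * (2 * R) ^ θ ≤ (1 - 2 * γ) * w₀ ^ 2 * (A * R ^ θ) := by
      rw [Real.mul_rpow (by norm_num) hRpos.le, hAdef]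
      have hw2 : 0 < (1 - 2 * γ) * w₀ ^ 2 := by positivity
      rw [show (1 - 2 * γ) * w₀ ^ 2 * (|C| * (2 : ℝ) ^ θ / ((1 - 2 * γ) * w₀ ^ 2) * R ^ θ) =
        |C| * ((2 : ℝ) ^ θ * R ^ θ) by field_simp]
      exact mul_le_mul_of_nonneg_right (le_abs_self C) (by positivity)
    have hw2 : 0 < (1 - 2 * γ) * w₀ ^ 2 := by positivity
    have hlt : TR - σ₁ ≤ A * R ^ θ := by
      have := hgrow.trans (henvY.trans hCA)
      rw [← mul_assoc] at this
      exact le_of_mul_le_mul_left this hw2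
    linarith only [hlt, hTR_ge, hσ₁n₀]
  -- ### conclusion: measure comparison
  have hmono := measure_mono (μ := volume) hincl
  have hn₀' : volume (Sn n₀) ≤ volume (ball x₀ r) / 2 := hn₀
  have hle : volume (ball x₀ r ∩ {y | ∀ σ ∈ Icc 0 TR, ‖Φ' (-σ) y‖ ≤ 2 * R}) ≤ volume (ball x₀ r) / 2 :=
    hmono.trans hn₀'
  have hne : volume (ball x₀ r) / 2 ≠ ∞ := ENNReal.div_ne_top hvtop.ne (by norm_num)
  have := ENNReal.toReal_mono hne hle
  rwa [ENNReal.toReal_div, ENNReal.toReal_ofNat] at this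

end DriftClock

end Summit.NavierStokesRegularity.NavierStokesRegularity.Theorems.PowerGaugeEulerLiouville

end
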